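import Literature.MathematicalPhysics.QuantumLattice.LiebMattisSectorPF
import Summits.Ventures.CertifiedQuantumChemistry.Rows.LiebSingletBridge
import HarnessLib

/-!
# Ventures/CertifiedQuantumChemistry — Rows/HeisenbergSpinHalfPerron.lean: the spin-½ Heisenberg Hamiltonian bond
# by bond, and the Perron–Frobenius identification of a sector energy (T-H8(α), part 1 of 2)

HONEST FRAMING (verbatim): certified bounds for a stated model Hamiltonian in a stated basis; not a
claim about the real molecule beyond that model.

Seat ref/typer (`pub-qchem-typer`, gen 21). Part 1 of the `L = 8` item INVITED by the lead (HOME/INBOX L888 /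
L891, RULINGS TYP-65 / TYP-68: 'T-H8(α) — a KERNEL theorem on `(heisenbergHamiltonian 1 (ringGraph 8) 1).groundEnergy`
… invited, never critical-path'). THEOREMS + one bookkeeping `def` (`heisenbergBondTerm`, the bond term of
`H φ`); no claim node, no row, no certificate; zero compute, standard axioms; scores nothing, moves no
`CERTIFIED.md` byte. Part 2 = `Rows/HeisenbergRingL8GroundEnergy.lean` (the 8-ring: the explicit Perron vector
over `ℤ[μ]`, the kernel check, `E₀ = 2 − μ/4`).

## What is proved (generic: any finite graph; §3 any spin)

* §1 the spin-½ exchange operator in the product basis, `⟨σ|𝐒_x·𝐒_y|τ⟩ = ±¼ δ_{στ}` (sign: `σ_x = σ_y` or not)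
  `+ ½ [σ_x ≠ σ_y, τ = σ ∘ swap x y]` (`spinDot_one_apply`, from the tree's general-spin entry formula
  `spinDot_apply_of_ne`), and its action on a wave function (`spinDot_one_mulVec_apply`);
  §2 **the spin-½ Heisenberg Hamiltonian acting on a wave function, bond by bond**:
  `(Hφ)(σ) = J Σ_{{x,y}∈E(G)} (¼φ(σ) if σ_x = σ_y, else −¼φ(σ) + ½φ(σ ∘ swap x y))`
  (`heisenbergHamiltonian_one_mulVec_apply`; Tasaki (2020) §2.4, eqs. (2.4.1), (2.4.3)).
* §3 **Perron–Frobenius identification of a sector energy** (`lowestEnergyInSector_eq_of_marshall_positive`; any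
  spin `n/2`, `H = J Σ 𝐒_x·𝐒_y`, `J > 0`, on a connected graph bipartite in `A`, `Aᶜ`): an eigenvector `Hφ = Eφ`
  supported in the weight sector `W` whose entries obey the Marshall sign rule STRICTLY
  (`(−1)^{Σ_A σ} φ(σ) > 0` on every configuration of weight `W`) has `E = E(W)`, the sector energy. Proof: the
  sector ground state is Marshall-positive by the tree's Marshall–Lieb–Mattis theorem
  `LiebMattis.sector_perronFrobenius`; eigenvectors of a Hermitian matrix to different real eigenvalues are
  orthogonal (`star_dotProduct_eq_zero_of_eigenvalue_ne`); two Marshall-positive vectors have inner product with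
  positive real part. This is the classical route by which an explicitly written positive eigenvector (Bethe's,
  or a finite exact one as in part 2) is identified as THE ground state (Yang–Yang, Phys. Rev. 150 (1966) 321, §II;
  Marshall (1955); Lieb–Mattis (1962) Thm 2; Tasaki (2020) Thm 2.3).
* §4 bond sums on the `L`-ring, `Σ_{e∈E(ringGraph L)} f e = Σ_i f{i, i+1 mod L}` (`3 ≤ L`; `sum_edgeFinset_ringGraph`,
  `sum_edgeFinset_ringGraph_eight`) — the edge set of `ringGraph L` is the injective image of `i ↦ {i, i+1}`
  (as in `Rows/HubbardHalfFilledHeisenbergSpinLimit.lean`'s edge count).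

References: Marshall, Proc. Roy. Soc. A 232 (1955) 48 [Marshall1955]; Lieb–Mattis, J. Math. Phys. 3 (1962) 749,
Thm 2 [LiebMattis1962]; Tasaki (2020) §2.4 [Tasaki2020]; Yang–Yang (1966) §II. Typer `pub-qchem-typer` (gen 21),
0 core-h.
-/

noncomputable section

namespace Summit.Ventures.CertifiedQuantumChemistry

open Matrix Finset
open Literature.MathematicalPhysics.QuantumLattice

/-! ## §1 The spin-½ exchange operator in the product basis, and §2 the bond-by-bond action of `H` -/

section SpinHalf

variable {Λ : Type*} [Fintype Λ] [DecidableEq Λ]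

/-- Spin-½ raising operator entries: `⟨k| S⁺ |l⟩ = [k = 0 ∧ l = 1]`. -/
private theorem spinRaise_one_apply (k l : Fin 2) : spinRaise 1 k l = if k = 0 ∧ l = 1 then 1 else 0 := by
  rw [spinRaise_apply]
  fin_cases k <;> fin_cases l <;> simp

/-- Spin-½ lowering operator entries: `⟨k| S⁻ |l⟩ = [k = 1 ∧ l = 0]`. -/
private theorem spinLower_one_apply (k l : Fin 2) : spinLower 1 k l = if k = 1 ∧ l = 0 then 1 else 0 := by
  rw [spinLower_eq_conjTranspose, Matrix.conjTranspose_apply, spinRaise_one_apply]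
  fin_cases k <;> fin_cases l <;> simp

/-- Spin-½ `Sᶻ` entries: `⟨k| Sᶻ |l⟩ = δ_{kl} (½ − k)`. -/
private theorem spinZ_one_apply (k l : Fin 2) :
    SpinOperators.spinZ 1 k l = if k = l then (1 / 2 : ℂ) - ((k : ℕ) : ℂ) else 0 := by
  rw [spinZ_apply]
  split_ifs
  · push_cast; ring
  · rfl

/-- `Fin 2 = {0, 1}`. -/
private theorem fin2_eq_zero_or_eq_one (a : Fin 2) : a = 0 ∨ a = 1 := by
  fin_cases a <;> simp

omit [Fintype Λ] in
/-- `σ ∘ swap x y` agrees with `σ` off `{x, y}`. -/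
theorem comp_swap_apply_of_ne {x y z : Λ} (σ : Λ → Fin 2) (hzx : z ≠ x) (hzy : z ≠ y) :
    (σ ∘ Equiv.swap x y) z = σ z := by
  simp [Equiv.swap_apply_of_ne_of_ne hzx hzy]

omit [Fintype Λ] in
/-- `(σ ∘ swap x y)_x = σ_y`. -/
theorem comp_swap_apply_left (x y : Λ) (σ : Λ → Fin 2) : (σ ∘ Equiv.swap x y) x = σ y := by simp

omit [Fintype Λ] in
/-- `(σ ∘ swap x y)_y = σ_x`. -/
theorem comp_swap_apply_right (x y : Λ) (σ : Λ → Fin 2) : (σ ∘ Equiv.swap x y) y = σ x := by simp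

omit [Fintype Λ] in
/-- A configuration `τ` agreeing with `σ` off `{x, y}` equals `σ ∘ swap x y` iff `τ_x = σ_y` and `τ_y = σ_x`. -/
private theorem eq_comp_swap_iff {x y : Λ} {σ τ : Λ → Fin 2} (hoff : ∀ z, z ≠ x → z ≠ y → σ z = τ z) :
    τ = σ ∘ Equiv.swap x y ↔ τ x = σ y ∧ τ y = σ x := by
  constructor
  · rintro rfl
    exact ⟨comp_swap_apply_left x y σ, comp_swap_apply_right x y σ⟩
  · rintro ⟨hx, hy⟩
    funext z
    by_cases hzx : z = x
    · subst hzx; rw [comp_swap_apply_left, hx]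
    by_cases hzy : z = y
    · subst hzy; rw [comp_swap_apply_right, hy]
    rw [comp_swap_apply_of_ne σ hzx hzy, hoff z hzx hzy]

omit [Fintype Λ] in
/-- Two configurations agreeing off `{x, y}`: `τ = σ` iff they agree at `x` and `y`. -/
private theorem eq_iff_of_agree' {x y : Λ} {σ τ : Λ → Fin 2} (hoff : ∀ z, z ≠ x → z ≠ y → σ z = τ z) :
    τ = σ ↔ τ x = σ x ∧ τ y = σ y := by
  constructor
  · rintro rfl
    exact ⟨rfl, rfl⟩
  · rintro ⟨hx, hy⟩
    funext z
    by_cases hzx : z = x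
    · subst hzx; exact hx
    by_cases hzy : z = y
    · subst hzy; exact hy
    exact (hoff z hzx hzy).symm

/-- **The spin-½ exchange operator in the product basis** (`x ≠ y`), as the sum of its diagonal part
(`¼` if `σ_x = σ_y`, `−¼` otherwise) and its spin-flip part (`½` between `σ` with `σ_x ≠ σ_y` and the
exchanged configuration `σ ∘ swap x y`). -/
theorem spinDot_one_apply {x y : Λ} (hxy : x ≠ y) (σ τ : Λ → Fin 2) :
    spinDot 1 x y σ τ =
      (if τ = σ then (if σ x = σ y then (1 / 4 : ℂ) else -(1 / 4 : ℂ)) else 0) +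
        (if σ x ≠ σ y ∧ τ = σ ∘ Equiv.swap x y then (1 / 2 : ℂ) else 0) := by
  rw [spinDot_apply_of_ne 1 hxy σ τ, spinRaise_one_apply, spinRaise_one_apply, spinLower_one_apply,
    spinLower_one_apply, spinZ_one_apply, spinZ_one_apply]
  by_cases hoff : ∀ z, z ≠ x → z ≠ y → σ z = τ z
  · rw [if_pos hoff]
    simp only [eq_comp_swap_iff hoff, eq_iff_of_agree' hoff]
    rcases fin2_eq_zero_or_eq_one (σ x) with hsx | hsx <;> rcases fin2_eq_zero_or_eq_one (σ y) with hsy | hsy <;>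
      rcases fin2_eq_zero_or_eq_one (τ x) with htx | htx <;> rcases fin2_eq_zero_or_eq_one (τ y) with hty | hty <;>
      norm_num [hsx, hsy, htx, hty]
  · rw [if_neg hoff, if_neg, if_neg, add_zero]
    · rintro ⟨-, rfl⟩
      exact hoff fun z hzx hzy => (comp_swap_apply_of_ne σ hzx hzy).symm
    · rintro rfl
      exact hoff fun z _ _ => rfl

/-- **The spin-½ exchange operator acting on a wave function**: for `x ≠ y`,
`(𝐒_x·𝐒_y φ)(σ) = ¼ φ(σ)` if `σ_x = σ_y`, and `−¼ φ(σ) + ½ φ(σ ∘ swap x y)` otherwise. -/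
theorem spinDot_one_mulVec_apply {x y : Λ} (hxy : x ≠ y) (φ : (Λ → Fin 2) → ℂ) (σ : Λ → Fin 2) :
    (spinDot 1 x y *ᵥ φ) σ =
      if σ x = σ y then (1 / 4 : ℂ) * φ σ else -(1 / 4 : ℂ) * φ σ + (1 / 2 : ℂ) * φ (σ ∘ Equiv.swap x y) := by
  rw [Matrix.mulVec, dotProduct]
  by_cases hc : σ x = σ y
  · simp only [spinDot_one_apply hxy σ, hc, ite_mul, zero_mul, Finset.sum_ite_eq', Finset.mem_univ, if_true,
      ne_eq, not_true_eq_false, false_and, if_false, add_zero]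
  · simp only [spinDot_one_apply hxy σ, hc, add_mul, Finset.sum_add_distrib, ite_mul, zero_mul,
      Finset.sum_ite_eq', Finset.mem_univ, if_true, ne_eq, not_false_eq_true, true_and, if_false]

end SpinHalf

section Graph

variable {Λ : Type*} [Fintype Λ] [DecidableEq Λ] (G : SimpleGraph Λ) [DecidableRel G.Adj] (J : ℝ)

/-- The bond term of the spin-½ Heisenberg Hamiltonian acting on `φ` at the configuration `σ`, for the
bond `{x, y}`: `¼ φ(σ)` on a parallel bond, `−¼ φ(σ) + ½ φ(σ ∘ swap x y)` on an antiparallel one. -/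
def heisenbergBondTerm (φ : (Λ → Fin 2) → ℂ) (σ : Λ → Fin 2) (x y : Λ) : ℂ :=
  if σ x = σ y then (1 / 4 : ℂ) * φ σ else -(1 / 4 : ℂ) * φ σ + (1 / 2 : ℂ) * φ (σ ∘ Equiv.swap x y)

omit [Fintype Λ] in
/-- The bond term is symmetric in the two sites. -/
theorem heisenbergBondTerm_comm (φ : (Λ → Fin 2) → ℂ) (σ : Λ → Fin 2) (x y : Λ) :
    heisenbergBondTerm φ σ x y = heisenbergBondTerm φ σ y x := by
  unfold heisenbergBondTerm
  rw [Equiv.swap_comm]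
  by_cases h : σ x = σ y
  · rw [if_pos h, if_pos h.symm]
  · rw [if_neg h, if_neg (Ne.symm h)]

/-- **The spin-½ Heisenberg Hamiltonian acting on a wave function**, bond by bond:
`(H φ)(σ) = J Σ_{{x,y} ∈ E(G)} (¼ φ(σ) if σ_x = σ_y, else −¼ φ(σ) + ½ φ(σ ∘ swap x y))`. -/
theorem heisenbergHamiltonian_one_mulVec_apply (φ : (Λ → Fin 2) → ℂ) (σ : Λ → Fin 2) :
    (heisenbergHamiltonian 1 G J *ᵥ φ) σ =
      (J : ℂ) * ∑ e ∈ G.edgeFinset, Sym2.lift ⟨heisenbergBondTerm φ σ, heisenbergBondTerm_comm φ σ⟩ e := by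
  unfold heisenbergHamiltonian
  rw [Matrix.smul_mulVec, Pi.smul_apply, smul_eq_mul, Matrix.sum_mulVec, Finset.sum_apply]
  congr 1
  refine Finset.sum_congr rfl fun e he => ?_
  induction e using Sym2.ind with
  | h x y =>
    have hxy : x ≠ y := G.ne_of_adj (SimpleGraph.mem_edgeFinset.1 he)
    rw [spinDotSym_mk, Sym2.lift_mk, spinDot_one_mulVec_apply hxy]
    rfl

end Graph

/-! ## §3 Perron–Frobenius identification of a sector energy, and §4 bond sums on the ring -/

section PerronFrobenius

variable {Λ : Type*} [Fintype Λ] [DecidableEq Λ] (n : ℕ) (G : SimpleGraph Λ) [DecidableRel G.Adj] (J : ℝ)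

/-- Eigenvectors of a Hermitian matrix for two distinct real eigenvalues are orthogonal. -/
theorem star_dotProduct_eq_zero_of_eigenvalue_ne {ι : Type*} [Fintype ι] {A : Matrix ι ι ℂ}
    (hA : A.IsHermitian) {ψ φ : ι → ℂ} {a b : ℝ} (hψ : A *ᵥ ψ = (a : ℂ) • ψ) (hφ : A *ᵥ φ = (b : ℂ) • φ)
    (hab : a ≠ b) : star ψ ⬝ᵥ φ = 0 := by
  have h1 : star ψ ⬝ᵥ (A *ᵥ φ) = (b : ℂ) * (star ψ ⬝ᵥ φ) := by
    rw [hφ, dotProduct_smul, smul_eq_mul]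
  have h3 : star ψ ᵥ* A = (a : ℂ) • star ψ := by
    have h := Matrix.star_mulVec A ψ
    rw [hA.eq, hψ, star_smul, Complex.star_def, Complex.conj_ofReal] at h
    exact h.symm
  have h2 : star ψ ⬝ᵥ (A *ᵥ φ) = (a : ℂ) * (star ψ ⬝ᵥ φ) := by
    rw [Matrix.dotProduct_mulVec, h3, smul_dotProduct, smul_eq_mul]
  have h4 : ((b : ℂ) - a) * (star ψ ⬝ᵥ φ) = 0 := by rw [sub_mul, ← h1, ← h2, sub_self]
  rcases mul_eq_zero.1 h4 with h | h
  · exact absurd (Complex.ofReal_injective (sub_eq_zero.1 h)) (Ne.symm hab)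
  · exact h

/-- **Perron–Frobenius identification of a sector energy.** For the antiferromagnet `H = J Σ 𝐒_x·𝐒_y`
(`J > 0`) on a connected graph bipartite in `A`, `Aᶜ`, an eigenvector `H φ = E φ` supported in the weight
sector `W` whose entries obey the Marshall sign rule STRICTLY (`(-1)^{Σ_A σ} φ(σ) > 0` on every
configuration of weight `W`) has the sector energy as its eigenvalue: `E(W) = E`. (The sector ground
state is Marshall-positive by the Marshall–Lieb–Mattis theorem `LiebMattis.sector_perronFrobenius`, and two
Marshall-positive vectors are never orthogonal.) -/
theorem lowestEnergyInSector_eq_of_marshall_positive (A : Finset Λ) (hG : G.Connected)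
    (hA : G.IsBipartiteWith (A : Set Λ) (↑A)ᶜ) (hJ : 0 < J) (W : ℕ)
    (hW : ∃ σ : TensorIndex Λ (n + 1), (∑ z, (σ z : ℕ)) = W)
    {φ : TensorIndex Λ (n + 1) → ℂ}
    (hφ : φ ∈ spinZSector (Λ := Λ) n (((Fintype.card Λ * n : ℕ) : ℝ) / 2 - W)) {E : ℝ}
    (hHφ : heisenbergHamiltonian n G J *ᵥ φ = (E : ℂ) • φ)
    (hpos : ∀ σ : TensorIndex Λ (n + 1), (∑ z, (σ z : ℕ)) = W →
      0 < (marshallSign A σ * φ σ).re ∧ (marshallSign A σ * φ σ).im = 0) :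
    lowestEnergyInSector n (heisenbergHamiltonian n G J) (((Fintype.card Λ * n : ℕ) : ℝ) / 2 - W) = E := by
  obtain ⟨⟨ψ, hψK, hψ0, hHψ⟩, -, -, hsign⟩ := LiebMattis.sector_perronFrobenius n G J A hG hA hJ W hW
  obtain ⟨c, hc0, hcpos⟩ := hsign ψ hψK hHψ hψ0
  by_contra hne
  have horth : star ψ ⬝ᵥ φ = 0 :=
    star_dotProduct_eq_zero_of_eigenvalue_ne (heisenbergHamiltonian_isHermitian n G J) hHψ hHφ hne
  have hφ0 : ∀ σ : TensorIndex Λ (n + 1), (∑ z, (σ z : ℕ)) ≠ W → φ σ = 0 :=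
    (LiebMattis.mem_spinZSector_weight_iff n W φ).1 hφ
  -- termwise: `conj(ψ σ) φ σ · conj c = (c m ψ σ)(m φ σ)` with `m` the Marshall sign
  have hterm : ∀ σ : TensorIndex Λ (n + 1), star (ψ σ) * φ σ * star c =
      (c * marshallSign A σ * ψ σ) * (marshallSign A σ * φ σ) := by
    intro σ
    by_cases hσ : (∑ z, (σ z : ℕ)) = W
    · have hreal : star (c * marshallSign A σ * ψ σ) = c * marshallSign A σ * ψ σ :=
        Complex.conj_eq_iff_im.2 (hcpos σ hσ).2
      have hmm := LiebMattis.marshallSign_mul_self A σ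
      have hcψ : star (c * ψ σ) = c * ψ σ := by
        rw [star_mul', star_mul', LiebMattis.star_marshallSign] at hreal
        calc star (c * ψ σ) = star c * star (ψ σ) * (marshallSign A σ * marshallSign A σ) := by
              rw [hmm, mul_one, star_mul']
          _ = star c * marshallSign A σ * star (ψ σ) * marshallSign A σ := by ring
          _ = c * marshallSign A σ * ψ σ * marshallSign A σ := by rw [hreal]
          _ = c * ψ σ := by rw [mul_assoc, mul_comm (ψ σ), ← mul_assoc, mul_assoc c, hmm, mul_one]
      rw [star_mul'] at hcψ
      calc star (ψ σ) * φ σ * star c = star c * star (ψ σ) * φ σ := by ring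
        _ = c * ψ σ * φ σ := by rw [hcψ]
        _ = c * marshallSign A σ * ψ σ * (marshallSign A σ * φ σ) := by
            rw [show c * marshallSign A σ * ψ σ * (marshallSign A σ * φ σ) =
              c * ψ σ * φ σ * (marshallSign A σ * marshallSign A σ) by ring, hmm, mul_one]
    · rw [hφ0 σ hσ, mul_zero, zero_mul, mul_zero, mul_zero]
  have hsum : (star ψ ⬝ᵥ φ) * star c =
      ∑ σ, (c * marshallSign A σ * ψ σ) * (marshallSign A σ * φ σ) := by
    rw [dotProduct, Finset.sum_mul]
    exact Finset.sum_congr rfl fun σ _ => by rw [Pi.star_apply, hterm σ]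
  -- the right-hand side has positive real part
  have hre : 0 < (∑ σ : TensorIndex Λ (n + 1),
      (c * marshallSign A σ * ψ σ) * (marshallSign A σ * φ σ)).re := by
    rw [Complex.re_sum]
    obtain ⟨σ₀, hσ₀⟩ := hW
    have hnn : ∀ σ ∈ (Finset.univ : Finset (TensorIndex Λ (n + 1))),
        0 ≤ ((c * marshallSign A σ * ψ σ) * (marshallSign A σ * φ σ)).re := by
      intro σ _
      by_cases hσ : (∑ z, (σ z : ℕ)) = W
      · rw [Complex.mul_re, (hcpos σ hσ).2, zero_mul, sub_zero]
        exact mul_nonneg (hcpos σ hσ).1.le (hpos σ hσ).1.le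
      · rw [hφ0 σ hσ, mul_zero, mul_zero, Complex.zero_re]
    have hlt : 0 < ((c * marshallSign A σ₀ * ψ σ₀) * (marshallSign A σ₀ * φ σ₀)).re := by
      rw [Complex.mul_re, (hcpos σ₀ hσ₀).2, zero_mul, sub_zero]
      exact mul_pos (hcpos σ₀ hσ₀).1 (hpos σ₀ hσ₀).1
    exact lt_of_lt_of_le hlt (Finset.single_le_sum hnn (Finset.mem_univ σ₀))
  rw [horth, zero_mul] at hsum
  rw [← hsum, Complex.zero_re] at hre
  exact lt_irrefl 0 hre

end PerronFrobenius

section RingSum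

open Summit.Ventures.CertifiedQuantumChemistry.Hamiltonians

/-- On the `L`-ring with `2 ≤ L` the successor `(i + 1) mod L` of a site differs from it. -/
private theorem succ_mod_ne_self' {L : ℕ} (hL : 2 ≤ L) (i : Fin L) : (i.val + 1) % L ≠ i.val := by
  have hi := i.isLt
  rcases Nat.lt_or_ge (i.val + 1) L with h | h
  · rw [Nat.mod_eq_of_lt h]; omega
  · rw [show i.val + 1 = L by omega, Nat.mod_self]; omega

/-- **Bond sums on the `L`-ring** (`3 ≤ L`): the edges of `ringGraph L` are the `L` distinct pairs
`{i, i + 1 mod L}`, so `Σ_{e ∈ E(ringGraph L)} f(e) = Σ_{i} f {i, i+1}`. -/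
theorem sum_edgeFinset_ringGraph {L : ℕ} (hL : 3 ≤ L) {M : Type*} [AddCommMonoid M] (f : Sym2 (Fin L) → M) :
    ∑ e ∈ (ringGraph L).edgeFinset, f e =
      ∑ i : Fin L, f s(i, ⟨(i.val + 1) % L, Nat.mod_lt _ (by omega)⟩) := by
  classical
  have hL0 : 0 < L := by omega
  let nx : Fin L → Fin L := fun i => ⟨(i.val + 1) % L, Nat.mod_lt _ hL0⟩
  have hadj : ∀ i, (ringGraph L).Adj i (nx i) := fun i =>
    ⟨fun h => succ_mod_ne_self' (by omega) i (congrArg Fin.val h).symm, Or.inl rfl⟩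
  have himage : (ringGraph L).edgeFinset = Finset.univ.image fun i => s(i, nx i) := by
    ext e
    rw [SimpleGraph.mem_edgeFinset, Finset.mem_image]
    induction e using Sym2.ind with
    | h p q =>
      rw [SimpleGraph.mem_edgeSet]
      constructor
      · rintro ⟨-, h | h⟩
        · exact ⟨p, Finset.mem_univ _, by rw [show nx p = q from Fin.ext h]⟩
        · refine ⟨q, Finset.mem_univ _, ?_⟩
          rw [show nx q = p from Fin.ext h, Sym2.eq_swap]
      · rintro ⟨i, -, hi⟩
        rw [Sym2.eq_iff] at hi
        rcases hi with ⟨rfl, rfl⟩ | ⟨rfl, rfl⟩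
        · exact hadj i
        · exact (hadj i).symm
  have hinj : Function.Injective fun i : Fin L => s(i, nx i) := by
    intro i j hij
    have hi := i.isLt
    have hj := j.isLt
    simp only at hij
    rw [Sym2.eq_iff] at hij
    rcases hij with ⟨h, -⟩ | ⟨h1, h2⟩
    · exact h
    · exfalso
      have e1 : i.val = (j.val + 1) % L := congrArg Fin.val h1
      have e2 : (i.val + 1) % L = j.val := congrArg Fin.val h2
      rcases Nat.lt_or_ge (j.val + 1) L with hj' | hj'
      · rw [Nat.mod_eq_of_lt hj'] at e1
        rcases Nat.lt_or_ge (i.val + 1) L with hi' | hi'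
        · rw [Nat.mod_eq_of_lt hi'] at e2; omega
        · rw [show i.val + 1 = L by omega, Nat.mod_self] at e2; omega
      · rw [show j.val + 1 = L by omega, Nat.mod_self] at e1
        rcases Nat.lt_or_ge (i.val + 1) L with hi' | hi'
        · rw [Nat.mod_eq_of_lt hi'] at e2; omega
        · rw [show i.val + 1 = L by omega, Nat.mod_self] at e2; omega
  rw [himage, Finset.sum_image fun i _ j _ h => hinj h]

/-- The 8-ring: `Σ_{e ∈ E(ringGraph 8)} f(e) = Σ_{i : Fin 8} f {i, i + 1}` (`Fin 8` arithmetic). -/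
theorem sum_edgeFinset_ringGraph_eight {M : Type*} [AddCommMonoid M] (f : Sym2 (Fin 8) → M) :
    ∑ e ∈ (ringGraph 8).edgeFinset, f e = ∑ i : Fin 8, f s(i, i + 1) := by
  rw [sum_edgeFinset_ringGraph (by norm_num) f]
  refine Finset.sum_congr rfl fun i _ => ?_
  congr 2

end RingSum


end Summit.Ventures.CertifiedQuantumChemistry

end
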